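import Summits.CriticalPhenomena.PercolationContinuityZ3.Theorems.PercNearOneGluingNoHeavyLowerTailIncStarC5Reduction
import Summits.CriticalPhenomena.PercolationContinuityZ3.Theorems.PercNearOneGluingNoHeavyLowerTailIncStarAnyPairTangent
import Summits.CriticalPhenomena.PercolationContinuityZ3.Theorems.PercNearOneGluingNoHeavyLowerTailFrontierDecRowsClusterBHK3KeyT
import Summits.CriticalPhenomena.PercolationContinuityZ3.Theorems.PercNearOneGluingAdditiveGluingBystanderThm2
import Mathlib.Combinatorics.SimpleGraph.Connectivity.Connected
import HarnessLib

/-!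
# The increasing star from ONE step at the distinguished target: the C5 induction schema (Sahi programme, prover prim-sahi-p2 gen 40)

Support file (`--supports stmt-CriticalPhenomena-4575`, helper).  No definitions, no named facts, no sorries; standard axioms.
Memo `run/shared/lean/prim/prim-sahi/FROM-prim-sahi-p2-gen40-C5-LIGHT-INDUCTION.md` §3, `prim-sahi-p2/PROOF-E3.md` §50.

Write `C5(P; s; a; b, c) := 2P(A∩B∩C) + P(A)P(B)P(C) − P(A)P(B∩C) − 2P(B)P(A∩C)` for the star events `A = {s↔a}, B = {s↔b}, C = {s↔c}` (written out in
full below; `C5(a;b,c) + C5(a;c,b) = 2E₃`, `IncStar.c5_add_c5_swap`).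

**`c5_nonneg_of_targetPairStep`.**  Suppose that for every weight `w`, every marking `(s; a; b, c)` and every FRACTIONAL pair `s(a,z)` AT THE DISTINGUISHED
TARGET `a` (`z ≠ a` arbitrary: root, target or unmarked), the form `C5(P_w; s; a; b, c)` is nonnegative GRANTED `C5 ≥ 0` for every weight with fewer fractional
pairs and every marking (the induction hypothesis of the loaded induction).  Then `C5(P_w; s; a; b, c) ≥ 0` for every finite weighted graph and every marking, hence
(`c5_family_incStar`) the increasing star `E₃({s↔a},{s↔b},{s↔c}) ≥ 0` and (`c5_family_incStarPlus`) `E₃ ≥ |P(B)P(A∩C) − P(C)P(A∩B)|` on every finite weighted graph.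

Proof = the bookkeeping of the memo's §3: strong induction on the number of fractional pairs; loops are switched off; the target `a` is moved along weight-`1`
pairs (`c5_eq_of_weight_one`: if `w s(a,u) = 1` then `{x↔a} = {x↔u}` almost surely, so the form is unchanged), so that either some vertex of the weight-`1` class of
`a` carries a fractional pair (the hypothesis applies there), or the class contains the root (`C5 = Cov ≥ 0`, Harris), or every pair leaving the class has weight `0`
and `{s↔a}` is null (`real_openConn_eq_zero_of_closedClass`, with the tree's `FrontierDecRows.real_setOf_mem_eq_zero`), so the form vanishes.  The a–root and a–target steps are theorems of the tree
(`IncStar.c5_rootTarget_tcy_polar_nonneg`, `IncStar.c5_targetTarget_*_polar_nonneg` with `IncStar.c5_nonneg_of_bernstein`); the a–unmarked step is OPEN (memo §3) —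
nothing in this file asserts it.
-/

noncomputable section

namespace Summit.CriticalPhenomena.PercolationContinuityZ3.Theorems

namespace IncStar

open MeasureTheory Set Literature.Probability.Percolation Literature.Probability.LatticeModels EdgeInduction
open scoped Classical

variable {n : ℕ}

/-! ### Almost-sure bookkeeping for pairs of weight `1` and `0` -/

/-- If `w s(a,u) = 1` (`a ≠ u`) then `{x ↔ a} = {x ↔ u}` almost surely under `prodBernoulli w`. [folklore] -/
theorem openConn_ae_eq_of_weight_one (w : Sym2 (Fin n) → unitInterval) {a u : Fin n} (hau : a ≠ u) (h1 : w s(a, u) = 1) (x : Fin n) :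
    (openConn x a : Set (BondConfig (Fin n))) =ᵐ[prodBernoulli w] openConn x u := by
  rw [Filter.eventuallyEq_set, ae_iff]
  have hsub : {ω : BondConfig (Fin n) | ¬(ω ∈ openConn x a ↔ ω ∈ openConn x u)} ⊆ {ω | s(a, u) ∉ ω} := by
    intro ω hω hmem
    apply hω
    have hadj : (openGraph ω).Adj a u := by rw [openGraph_adj]; exact ⟨hmem, hau⟩
    simp only [openConn, Set.mem_setOf_eq]
    exact ⟨fun h => h.trans hadj.reachable, fun h => h.trans hadj.reachable.symm⟩
  have h0 : (prodBernoulli w) {ω : BondConfig (Fin n) | s(a, u) ∉ ω} = 0 :=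
    (measureReal_eq_zero_iff (measure_ne_top _ _)).1 (FrontierDecRows.real_setOf_notMem_eq_zero w h1)
  exact measure_mono_null hsub h0

/-- **Moving the distinguished target along a weight-`1` pair does not change the form.**  If `w s(a,u) = 1` then
`C5(P_w; s; a; b, c) = C5(P_w; s; u; b, c)`. [this work] -/
theorem c5_eq_of_weight_one (w : Sym2 (Fin n) → unitInterval) {a u : Fin n} (hau : a ≠ u) (h1 : w s(a, u) = 1) (s b c : Fin n) :
    let μ := prodBernoulli w
    2 * μ.real (openConn s a ∩ openConn s b ∩ openConn s c) + μ.real (openConn s a) * μ.real (openConn s b) * μ.real (openConn s c)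
        - μ.real (openConn s a) * μ.real (openConn s b ∩ openConn s c) - 2 * (μ.real (openConn s b) * μ.real (openConn s a ∩ openConn s c)) =
      2 * μ.real (openConn s u ∩ openConn s b ∩ openConn s c) + μ.real (openConn s u) * μ.real (openConn s b) * μ.real (openConn s c)
        - μ.real (openConn s u) * μ.real (openConn s b ∩ openConn s c) - 2 * (μ.real (openConn s b) * μ.real (openConn s u ∩ openConn s c)) := by
  intro μ
  have h := openConn_ae_eq_of_weight_one w hau h1 s
  have hA : μ.real (openConn s a) = μ.real (openConn s u) := measureReal_congr h
  have hABC : μ.real (openConn s a ∩ openConn s b ∩ openConn s c) = μ.real (openConn s u ∩ openConn s b ∩ openConn s c) :=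
    measureReal_congr ((h.inter Filter.EventuallyEq.rfl).inter Filter.EventuallyEq.rfl)
  have hAC : μ.real (openConn s a ∩ openConn s c) = μ.real (openConn s u ∩ openConn s c) :=
    measureReal_congr (h.inter Filter.EventuallyEq.rfl)
  rw [hA, hABC, hAC]

/-- Transport of the form along a walk in the graph of weight-`1` pairs. [this work] -/
theorem c5_eq_of_weightOneWalk (w : Sym2 (Fin n) → unitInterval) (s b c : Fin n) {a u : Fin n}
    (p : (SimpleGraph.fromRel fun x y : Fin n => w s(x, y) = 1).Walk a u) :
    let μ := prodBernoulli w
    2 * μ.real (openConn s a ∩ openConn s b ∩ openConn s c) + μ.real (openConn s a) * μ.real (openConn s b) * μ.real (openConn s c)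
        - μ.real (openConn s a) * μ.real (openConn s b ∩ openConn s c) - 2 * (μ.real (openConn s b) * μ.real (openConn s a ∩ openConn s c)) =
      2 * μ.real (openConn s u ∩ openConn s b ∩ openConn s c) + μ.real (openConn s u) * μ.real (openConn s b) * μ.real (openConn s c)
        - μ.real (openConn s u) * μ.real (openConn s b ∩ openConn s c) - 2 * (μ.real (openConn s b) * μ.real (openConn s u ∩ openConn s c)) := by
  intro μ
  induction p with
  | nil => rfl
  | @cons x y z hxy _ ih =>
      rw [SimpleGraph.fromRel_adj] at hxy
      have h1 : w s(x, y) = 1 := by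
        rcases hxy.2 with h | h
        · exact h
        · rw [Sym2.eq_swap]; exact h
      have step := c5_eq_of_weight_one w hxy.1 h1 s b c
      simp only [μ] at step ih ⊢
      rw [step, ih]

/-- **A closed class sees nothing.**  If every pair leaving a set `U` of vertices has weight `0` and `s ∉ U ∋ a`, then `{s ↔ a}` is null. [folklore] -/
theorem real_openConn_eq_zero_of_closedClass (w : Sym2 (Fin n) → unitInterval) (U : Set (Fin n)) {s a : Fin n} (hs : s ∉ U) (ha : a ∈ U)
    (hU : ∀ u z : Fin n, u ∈ U → z ∉ U → w s(u, z) = 0) :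
    (prodBernoulli w).real (openConn s a) = 0 := by
  -- `{s ↔ a}` is contained in the union of the null events `{e open}` over the pairs `e` leaving `U`
  have hsub : (openConn s a : Set (BondConfig (Fin n))) ⊆
      ⋃ e ∈ (Finset.univ.filter fun e : Sym2 (Fin n) => w e = 0), {ω : BondConfig (Fin n) | e ∈ ω} := by
    intro ω hω
    simp only [openConn, Set.mem_setOf_eq] at hω
    obtain ⟨p⟩ := hω.symm
    -- walk from `a ∈ U` to `s ∉ U`: it has a dart leaving `U`
    obtain ⟨d, -, hd1, hd2⟩ := p.exists_boundary_dart U ha hs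
    have hadj := d.adj
    rw [openGraph_adj] at hadj
    simp only [Set.mem_iUnion, Finset.mem_filter, Finset.mem_univ, true_and, Set.mem_setOf_eq]
    exact ⟨s(d.toProd.1, d.toProd.2), hU _ _ hd1 hd2, hadj.1⟩
  have hnull : (prodBernoulli w).real (⋃ e ∈ (Finset.univ.filter fun e : Sym2 (Fin n) => w e = 0), {ω : BondConfig (Fin n) | e ∈ ω}) = 0 := by
    apply le_antisymm _ measureReal_nonneg
    refine (measureReal_biUnion_finset_le _ _).trans ?_
    apply le_of_eq
    apply Finset.sum_eq_zero
    intro e he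
    rw [Finset.mem_filter] at he
    exact FrontierDecRows.real_setOf_mem_eq_zero w he.2
  apply le_antisymm _ measureReal_nonneg
  calc (prodBernoulli w).real (openConn s a)
      ≤ (prodBernoulli w).real (⋃ e ∈ (Finset.univ.filter fun e : Sym2 (Fin n) => w e = 0), {ω : BondConfig (Fin n) | e ∈ ω}) :=
        measureReal_mono hsub (measure_ne_top _ _)
    _ = 0 := hnull

/-- The six star probabilities are invariant under removing a loop (so `C5` does not see loops). [folklore] -/
theorem c5_update_diag_zero (v : Sym2 (Fin n) → unitInterval) {g : Sym2 (Fin n)} (hg : g.IsDiag) (s a b c : Fin n) :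
    let μ := prodBernoulli (Function.update v g 0)
    let ν := prodBernoulli v
    2 * μ.real (openConn s a ∩ openConn s b ∩ openConn s c) + μ.real (openConn s a) * μ.real (openConn s b) * μ.real (openConn s c)
        - μ.real (openConn s a) * μ.real (openConn s b ∩ openConn s c) - 2 * (μ.real (openConn s b) * μ.real (openConn s a ∩ openConn s c)) =
      2 * ν.real (openConn s a ∩ openConn s b ∩ openConn s c) + ν.real (openConn s a) * ν.real (openConn s b) * ν.real (openConn s c)
        - ν.real (openConn s a) * ν.real (openConn s b ∩ openConn s c) - 2 * (ν.real (openConn s b) * ν.real (openConn s a ∩ openConn s c)) := by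
  intro μ ν
  obtain ⟨h7, hA, hB, hC, hBC, hAC, -⟩ := star_events_sdiff_diag (n := n) hg s a b c
  simp only [μ, ν, real_update_diag_zero _ _ h7, real_update_diag_zero _ _ hA, real_update_diag_zero _ _ hB, real_update_diag_zero _ _ hC,
    real_update_diag_zero _ _ hBC, real_update_diag_zero _ _ hAC]

/-! ### The schema -/

/-- **THE C5 FAMILY FROM ONE STEP AT THE DISTINGUISHED TARGET.**  Suppose that for every weight `w`, all `s a b c` and every fractional pair `s(a,z)`
(`z ≠ a`) at the distinguished target — granted `C5 ≥ 0` for every weight with fewer fractional pairs and every marking — the form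
`C5(P_w; s; a; b, c)` is nonnegative.  Then it is nonnegative for every finite weighted graph and every marking. [this work] -/
theorem c5_nonneg_of_targetPairStep
    (hStep : ∀ (v : Sym2 (Fin n) → unitInterval) (s a z b c : Fin n), a ≠ z → s(a, z) ∈ fracEdges v →
      (∀ v' : Sym2 (Fin n) → unitInterval, (fracEdges v').card < (fracEdges v).card → ∀ s' a' b' c' : Fin n,
          let μ := prodBernoulli v'
          0 ≤ 2 * μ.real (openConn s' a' ∩ openConn s' b' ∩ openConn s' c') + μ.real (openConn s' a') * μ.real (openConn s' b') * μ.real (openConn s' c')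
                - μ.real (openConn s' a') * μ.real (openConn s' b' ∩ openConn s' c') - 2 * (μ.real (openConn s' b') * μ.real (openConn s' a' ∩ openConn s' c'))) →
      let μ := prodBernoulli v
      0 ≤ 2 * μ.real (openConn s a ∩ openConn s b ∩ openConn s c) + μ.real (openConn s a) * μ.real (openConn s b) * μ.real (openConn s c)
            - μ.real (openConn s a) * μ.real (openConn s b ∩ openConn s c) - 2 * (μ.real (openConn s b) * μ.real (openConn s a ∩ openConn s c))) :
    ∀ (w : Sym2 (Fin n) → unitInterval) (s a b c : Fin n),
      let μ := prodBernoulli w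
      0 ≤ 2 * μ.real (openConn s a ∩ openConn s b ∩ openConn s c) + μ.real (openConn s a) * μ.real (openConn s b) * μ.real (openConn s c)
            - μ.real (openConn s a) * μ.real (openConn s b ∩ openConn s c) - 2 * (μ.real (openConn s b) * μ.real (openConn s a ∩ openConn s c)) := by
  suffices H : ∀ (k : ℕ) (v : Sym2 (Fin n) → unitInterval), (fracEdges v).card ≤ k → ∀ s a b c : Fin n,
      let μ := prodBernoulli v
      0 ≤ 2 * μ.real (openConn s a ∩ openConn s b ∩ openConn s c) + μ.real (openConn s a) * μ.real (openConn s b) * μ.real (openConn s c)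
            - μ.real (openConn s a) * μ.real (openConn s b ∩ openConn s c) - 2 * (μ.real (openConn s b) * μ.real (openConn s a ∩ openConn s c)) from
    fun w s a b c => H _ w le_rfl s a b c
  intro k
  induction k with
  | zero =>
      intro v hk s a b c
      have hv : ∀ e, v e = 0 ∨ v e = 1 := fun e => eq_zero_or_one_of_not_mem_fracEdges fun he => by
        have : 0 < (fracEdges v).card := Finset.card_pos.2 ⟨e, he⟩
        omega
      simp only
      rw [real_eq_ite_of_zeroOne v hv (openConn s a ∩ openConn s b ∩ openConn s c), real_eq_ite_of_zeroOne v hv (openConn s a),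
        real_eq_ite_of_zeroOne v hv (openConn s b), real_eq_ite_of_zeroOne v hv (openConn s c), real_eq_ite_of_zeroOne v hv (openConn s b ∩ openConn s c),
        real_eq_ite_of_zeroOne v hv (openConn s a ∩ openConn s c)]
      simp only [Set.mem_inter_iff]
      by_cases hA : {e | v e = 1} ∈ openConn s a <;> by_cases hB : {e | v e = 1} ∈ openConn s b <;>
        by_cases hC : {e | v e = 1} ∈ openConn s c <;> norm_num [hA, hB, hC]
  | succ k ih =>
      intro v hk s a b c
      have IH : ∀ v' : Sym2 (Fin n) → unitInterval, (fracEdges v').card < (fracEdges v).card → ∀ s' a' b' c' : Fin n,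
          let μ := prodBernoulli v'
          0 ≤ 2 * μ.real (openConn s' a' ∩ openConn s' b' ∩ openConn s' c') + μ.real (openConn s' a') * μ.real (openConn s' b') * μ.real (openConn s' c')
                - μ.real (openConn s' a') * μ.real (openConn s' b' ∩ openConn s' c') - 2 * (μ.real (openConn s' b') * μ.real (openConn s' a' ∩ openConn s' c')) :=
        fun v' hv' s' a' b' c' => ih v' (by omega) s' a' b' c'
      -- (0) a fractional loop is switched off
      by_cases hloop : ∃ g ∈ fracEdges v, g.IsDiag
      · obtain ⟨g, hg, hgd⟩ := hloop
        have e := c5_update_diag_zero v hgd s a b c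
        simp only at e ⊢
        rw [← e]
        exact IH _ (card_fracEdges_update_lt' v hg 0 (Or.inl rfl)) s a b c
      push Not at hloop
      -- the weight-1 graph and the class of `a`
      set W1 : SimpleGraph (Fin n) := SimpleGraph.fromRel fun x y : Fin n => v s(x, y) = 1 with hW1
      -- (i) some vertex of the class of `a` carries a fractional pair: move the target there and apply the step
      by_cases hfrac : ∃ u z : Fin n, W1.Reachable a u ∧ u ≠ z ∧ s(u, z) ∈ fracEdges v
      · obtain ⟨u, z, hau, huz, hg⟩ := hfrac
        obtain ⟨p⟩ := hau
        have e := c5_eq_of_weightOneWalk v s b c p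
        simp only at e ⊢
        rw [e]
        exact hStep v s u z b c huz hg IH
      push Not at hfrac
      -- (ii) the root lies in the class of `a`: the form is a covariance
      by_cases hroot : W1.Reachable a s
      · obtain ⟨p⟩ := hroot
        have e := c5_eq_of_weightOneWalk v s b c p
        simp only at e ⊢
        rw [e, v1362_openConn_self, Set.univ_inter, Set.univ_inter, probReal_univ]
        have hH := prodBernoulli_harris v (isUpperSet_openConn (V := Fin n) s b) (isUpperSet_openConn (V := Fin n) s c)
          MeasurableSet.of_discrete MeasurableSet.of_discrete
        nlinarith [hH]
      -- (iii) otherwise every pair leaving the class has weight 0, so `{s ↔ a}` is null and the form vanishes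
      · have hU : ∀ u z : Fin n, u ∈ {x | W1.Reachable a x} → z ∉ {x | W1.Reachable a x} → v s(u, z) = 0 := by
          intro u z hu hz
          simp only [Set.mem_setOf_eq] at hu hz
          have huz : u ≠ z := by rintro rfl; exact hz hu
          rcases eq_zero_or_one_of_not_mem_fracEdges (hfrac u z hu huz) with h | h
          · exact h
          · exact absurd (hu.trans (SimpleGraph.Adj.reachable (by rw [hW1, SimpleGraph.fromRel_adj]; exact ⟨huz, Or.inl h⟩))) hz
        have hs : s ∉ {x | W1.Reachable a x} := fun h => hroot h
        have h0 : (prodBernoulli v).real (openConn s a) = 0 :=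
          real_openConn_eq_zero_of_closedClass v {x | W1.Reachable a x} hs (SimpleGraph.Reachable.refl a) hU
        have h1 : (prodBernoulli v).real (openConn s a ∩ openConn s b ∩ openConn s c) = 0 :=
          le_antisymm (h0 ▸ measureReal_mono (fun ω hω => hω.1.1) (measure_ne_top _ _)) measureReal_nonneg
        have h2 : (prodBernoulli v).real (openConn s a ∩ openConn s c) = 0 :=
          le_antisymm (h0 ▸ measureReal_mono (fun ω hω => hω.1) (measure_ne_top _ _)) measureReal_nonneg
        simp only
        rw [h0, h1, h2]
        ring_nf
        rfl

/-- **The increasing star from the C5 family** (schema form): under the hypothesis of `c5_nonneg_of_targetPairStep`, `E₃({s↔a},{s↔b},{s↔c}) ≥ 0`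
on every finite weighted graph. [this work] -/
theorem c5_family_incStar
    (hStep : ∀ (v : Sym2 (Fin n) → unitInterval) (s a z b c : Fin n), a ≠ z → s(a, z) ∈ fracEdges v →
      (∀ v' : Sym2 (Fin n) → unitInterval, (fracEdges v').card < (fracEdges v).card → ∀ s' a' b' c' : Fin n,
          let μ := prodBernoulli v'
          0 ≤ 2 * μ.real (openConn s' a' ∩ openConn s' b' ∩ openConn s' c') + μ.real (openConn s' a') * μ.real (openConn s' b') * μ.real (openConn s' c')
                - μ.real (openConn s' a') * μ.real (openConn s' b' ∩ openConn s' c') - 2 * (μ.real (openConn s' b') * μ.real (openConn s' a' ∩ openConn s' c'))) →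
      let μ := prodBernoulli v
      0 ≤ 2 * μ.real (openConn s a ∩ openConn s b ∩ openConn s c) + μ.real (openConn s a) * μ.real (openConn s b) * μ.real (openConn s c)
            - μ.real (openConn s a) * μ.real (openConn s b ∩ openConn s c) - 2 * (μ.real (openConn s b) * μ.real (openConn s a ∩ openConn s c)))
    (w : Sym2 (Fin n) → unitInterval) (s a b c : Fin n) :
    0 ≤ sahiE3 (prodBernoulli w) (openConn s a) (openConn s b) (openConn s c) :=
  sahiE3_nonneg_of_c5 _ _ _ _ (c5_nonneg_of_targetPairStep hStep w s a b c) (c5_nonneg_of_targetPairStep hStep w s a c b)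

/-- **ISTAR⁺ from the C5 family** (schema form): under the same hypothesis, `E₃ ≥ |P(B)P(A∩C) − P(C)P(A∩B)|` for the star events. [this work] -/
theorem c5_family_incStarPlus
    (hStep : ∀ (v : Sym2 (Fin n) → unitInterval) (s a z b c : Fin n), a ≠ z → s(a, z) ∈ fracEdges v →
      (∀ v' : Sym2 (Fin n) → unitInterval, (fracEdges v').card < (fracEdges v).card → ∀ s' a' b' c' : Fin n,
          let μ := prodBernoulli v'
          0 ≤ 2 * μ.real (openConn s' a' ∩ openConn s' b' ∩ openConn s' c') + μ.real (openConn s' a') * μ.real (openConn s' b') * μ.real (openConn s' c')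
                - μ.real (openConn s' a') * μ.real (openConn s' b' ∩ openConn s' c') - 2 * (μ.real (openConn s' b') * μ.real (openConn s' a' ∩ openConn s' c'))) →
      let μ := prodBernoulli v
      0 ≤ 2 * μ.real (openConn s a ∩ openConn s b ∩ openConn s c) + μ.real (openConn s a) * μ.real (openConn s b) * μ.real (openConn s c)
            - μ.real (openConn s a) * μ.real (openConn s b ∩ openConn s c) - 2 * (μ.real (openConn s b) * μ.real (openConn s a ∩ openConn s c)))
    (w : Sym2 (Fin n) → unitInterval) (s a b c : Fin n) :
    |(prodBernoulli w).real (openConn s b) * (prodBernoulli w).real (openConn s a ∩ openConn s c)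
        - (prodBernoulli w).real (openConn s c) * (prodBernoulli w).real (openConn s a ∩ openConn s b)|
      ≤ sahiE3 (prodBernoulli w) (openConn s a) (openConn s b) (openConn s c) :=
  abs_le_sahiE3_of_c5 _ _ _ _ (c5_nonneg_of_targetPairStep hStep w s a b c) (c5_nonneg_of_targetPairStep hStep w s a c b)

end IncStar

end Summit.CriticalPhenomena.PercolationContinuityZ3.Theorems
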